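import Summits.QuantumFields.YangMills.Theorems.LuscherReductionDressedRitzPolyakovLiftTransplantRoot
import Mathlib.Analysis.SpecialFunctions.Trigonometric.ArctanDeriv
import Mathlib.Analysis.Calculus.Deriv.MeanValue
import HarnessLib

/-!
# Crux `DressedRitz` (stmt-QuantumFields-20205), line «polyakovlift» r6, wave 2 / F8c part 1a — the ROOT RESCALING IS 6-LIPSCHITZ on the chart ball,
# uniformly in `L` (radial geometry for the Lipschitz bound of the shadow observable)

Support module (fleet seat ym-20205-polyakovlift-s1 gen 2, for the LEAD's wave-2 brief W2-F8 (c) of `WAVE-2-BRIEFS.md`; `--supports stmt-QuantumFields-20205`,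
helper, no closure claim).  The registered r6 observables are `g_i = transplantFn R f i ∘ rootCoord L (Λ/2)` with the `L`-adapted root chart
`rootCoord L μ = rootRescale L μ ∘ gnCoord μ` (`…PolyakovLiftTransplantRoot`, p554989): per link, `±W = cos θ + sin θ n·σ ↦ L·tan(θ/L)·n/μ`.  The energy-norm
product lemma (F8a) needs `(g(U^L) − g(V^L))² ≤ Lg²·L²·cfgDist U V` with `Lg` INDEPENDENT of `L` (F8c part 2); this file proves the radial half:

* §1 calculus by the mean value theorem: `arctan_sub_arctan_le` (`arctan` is 1-Lipschitz), `tan_sub_tan_le_two_mul` (`tan` is 2-Lipschitz on `[0, π/4]`);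
* §2 the root profile `rootPsi L t = L·tan(arctan t / L)` (`= rootProfile L t · t`): for `L ≥ 1` and `0 ≤ t ≤ 1`, `arctan t ≤ rootPsi L t ≤ 2t`, `rootPsi` is
  2-Lipschitz on `[0,1]`, and `0 ≤ rootProfile L t ≤ 2` — ALL UNIFORM IN `L` (the only `L`-dependence, `tan(·/L)`, has slope `sec²(·/L) ≤ sec²(π/4) = 2`);
* §3 ★ `norm_radial_sub_radial_le` — an abstract radial map `z ↦ φ(‖z‖)•z` on a real normed space with `0 ≤ φ ≤ A` and `r ↦ φ(r)·r` `B`-Lipschitz on `[0,1]` is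
  `(2A+B)`-Lipschitz on the unit ball (no derivative at `0` needed); `linkVec` (the `ℝ³` vector of one link inside `ZM`); ★ `norm_rootRescale_sub_le`:
  `‖rootRescale L μ y − rootRescale L μ y'‖ ≤ 6‖y − y'‖` whenever every link of `y, y'` has `μ·‖y_i‖ ≤ 1`.

HONEST FRAMING: chart calculus at fixed lattice on the conditional femto rung R2b1; serves ONE stub's (S-PSCAL″) soft error; nothing here bears on infinite volume,
the continuum limit or the Clay gap.
References: Bröcker–tom Dieck I (1.10) [cite: BrockerTomDieck1985, I (1.10)]; M. Lüscher, NPB 219 (1983) 233 [cite: Luscher1983, §2].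
-/

set_option autoImplicit false

noncomputable section

open MeasureTheory Filter Topology Real
open scoped Matrix ComplexConjugate BigOperators
open Literature.MathematicalPhysics.QuantumFieldTheory
open Literature.MathematicalPhysics.QuantumLattice
open Literature.Analysis.OperatorTheory.YMMatrixModel (ZM)

namespace Summit.QuantumFields.YangMills.Theorems.FemtoTransferGap.PolyakovLift

open Summit.QuantumFields.YangMills.Theorems.FemtoTransferGap

/-! ## §1 Calculus: `arctan` is 1-Lipschitz, `tan` is 2-Lipschitz on `[0, π/4]` -/

/-- `arctan y − arctan x ≤ y − x` for `x ≤ y` (`arctan' = 1/(1+x²) ≤ 1`). [folklore] -/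
theorem arctan_sub_arctan_le {x y : ℝ} (hxy : x ≤ y) : Real.arctan y - Real.arctan x ≤ y - x := by
  have h := image_sub_le_mul_sub_of_deriv_le Real.differentiable_arctan (C := 1) (fun t => by
    rw [Real.deriv_arctan]
    rw [div_le_one (by positivity)]
    nlinarith [sq_nonneg t]) hxy
  simpa using h

/-- `|arctan y − arctan x| ≤ |y − x|`. [folklore] -/
theorem abs_arctan_sub_arctan_le (x y : ℝ) : |Real.arctan y - Real.arctan x| ≤ |y - x| := by
  rcases le_total x y with h | h
  · rw [abs_of_nonneg (sub_nonneg.2 (Real.arctan_mono h)), abs_of_nonneg (sub_nonneg.2 h)]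
    exact arctan_sub_arctan_le h
  · rw [abs_of_nonpos (sub_nonpos.2 (Real.arctan_mono h)), abs_of_nonpos (sub_nonpos.2 h), neg_sub, neg_sub]
    exact arctan_sub_arctan_le h

/-- `tan y − tan x ≤ 2(y − x)` for `0 ≤ x ≤ y ≤ π/4` (`tan' = sec² ≤ sec²(π/4) = 2` there; mean value theorem on `[0, π/4]`). [folklore] -/
theorem tan_sub_tan_le_two_mul {x y : ℝ} (h0 : 0 ≤ x) (hxy : x ≤ y) (hy : y ≤ π / 4) : Real.tan y - Real.tan x ≤ 2 * (y - x) := by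
  have hpi := Real.pi_pos
  have hcos : ∀ t ∈ Set.Icc (0 : ℝ) (π / 4), Real.cos (π / 4) ≤ Real.cos t ∧ 0 < Real.cos t := fun t ht => by
    have h1 : Real.cos (π / 4) ≤ Real.cos t := Real.cos_le_cos_of_nonneg_of_le_pi ht.1 (by linarith [ht.2]) ht.2
    exact ⟨h1, lt_of_lt_of_le (by rw [Real.cos_pi_div_four]; positivity) h1⟩
  have hcont : ContinuousOn Real.tan (Set.Icc 0 (π / 4)) :=
    Real.continuousOn_tan.mono fun t ht => (hcos t ht).2.ne'
  have hdiff : DifferentiableOn ℝ Real.tan (interior (Set.Icc 0 (π / 4))) := fun t ht => by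
    rw [interior_Icc] at ht
    exact (Real.differentiableAt_tan.2 (hcos t ⟨ht.1.le, ht.2.le⟩).2.ne').differentiableWithinAt
  have hder : ∀ t ∈ interior (Set.Icc (0 : ℝ) (π / 4)), deriv Real.tan t ≤ 2 := fun t ht => by
    rw [interior_Icc] at ht
    obtain ⟨hc4, hc0⟩ := hcos t ⟨ht.1.le, ht.2.le⟩
    rw [Real.deriv_tan, div_le_iff₀ (pow_pos hc0 2)]
    have h2 : Real.cos (π / 4) ^ 2 = 1 / 2 := by
      rw [Real.cos_pi_div_four, div_pow, Real.sq_sqrt (by norm_num : (0:ℝ) ≤ 2)]; norm_num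
    nlinarith [pow_le_pow_left₀ (by rw [Real.cos_pi_div_four]; positivity) hc4 2]
  exact (convex_Icc 0 (π / 4)).image_sub_le_mul_sub_of_deriv_le hcont hdiff hder x ⟨h0, hxy.trans hy⟩ y ⟨h0.trans hxy, hy⟩ hxy

/-! ## §2 The root profile `ψ_L(t) = L·tan(arctan t / L)` — bounds uniform in `L` -/

/-- `rootPsi L t = L·tan(arctan t / L)`, the radial length of the root chart (`= rootProfile L t · t`). [cite: Luscher1983, §2] -/
def rootPsi (L : ℕ) (t : ℝ) : ℝ := (L : ℝ) * Real.tan (Real.arctan t / L)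

/-- `rootProfile L t · t = rootPsi L t`. [folklore] -/
theorem rootProfile_mul_self (L : ℕ) (t : ℝ) : rootProfile L t * t = rootPsi L t := by
  unfold rootProfile rootPsi
  split_ifs with h
  · rw [h, Real.arctan_zero, zero_div, Real.tan_zero, mul_zero, mul_zero]
  · rw [div_mul_cancel₀ _ h]

/-- For `L ≥ 1` and `t ≥ 0`: `0 ≤ arctan t / L ≤ arctan t < π/2`, and `arctan t / L ≤ π/4` when `t ≤ 1`. [folklore] -/
theorem arctan_div_bounds {L : ℕ} (hL : 1 ≤ L) {t : ℝ} (ht : 0 ≤ t) :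
    0 ≤ Real.arctan t / L ∧ Real.arctan t / L ≤ Real.arctan t ∧ Real.arctan t / L < π / 2 := by
  have hL' : (1 : ℝ) ≤ L := by exact_mod_cast hL
  have ha : 0 ≤ Real.arctan t := Real.arctan_nonneg.2 ht
  refine ⟨div_nonneg ha (by linarith), div_le_self ha hL', ?_⟩
  exact lt_of_le_of_lt (div_le_self ha hL') (Real.arctan_lt_pi_div_two t)

/-- `rootPsi L t ≥ 0` for `t ≥ 0`, `L ≥ 1`. [folklore] -/
theorem rootPsi_nonneg {L : ℕ} (hL : 1 ≤ L) {t : ℝ} (ht : 0 ≤ t) : 0 ≤ rootPsi L t := by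
  obtain ⟨h0, -, h2⟩ := arctan_div_bounds hL ht
  exact mul_nonneg (Nat.cast_nonneg L) (Real.tan_nonneg_of_nonneg_of_le_pi_div_two h0 h2.le)

/-- **`arctan t ≤ rootPsi L t`** (`L·tan(a/L) ≥ a`), `t ≥ 0`, `L ≥ 1`. [folklore] -/
theorem arctan_le_rootPsi {L : ℕ} (hL : 1 ≤ L) {t : ℝ} (ht : 0 ≤ t) : Real.arctan t ≤ rootPsi L t := by
  obtain ⟨h0, -, h2⟩ := arctan_div_bounds hL ht
  have hL' : (0 : ℝ) < L := by exact_mod_cast hL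
  have h := Real.le_tan h0 h2
  calc Real.arctan t = (L : ℝ) * (Real.arctan t / L) := by field_simp
    _ ≤ (L : ℝ) * Real.tan (Real.arctan t / L) := mul_le_mul_of_nonneg_left h hL'.le

/-- **`rootPsi` is 2-Lipschitz and monotone on `[0,1]`**: `0 ≤ rootPsi L t' − rootPsi L t ≤ 2(t' − t)` for `0 ≤ t ≤ t' ≤ 1`, `L ≥ 1`. [folklore] -/
theorem rootPsi_sub_bounds {L : ℕ} (hL : 1 ≤ L) {t t' : ℝ} (ht : 0 ≤ t) (htt' : t ≤ t') (ht' : t' ≤ 1) :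
    0 ≤ rootPsi L t' - rootPsi L t ∧ rootPsi L t' - rootPsi L t ≤ 2 * (t' - t) := by
  have hL' : (0 : ℝ) < L := by exact_mod_cast hL
  have hL1 : (1 : ℝ) ≤ L := by exact_mod_cast hL
  obtain ⟨h0, -, -⟩ := arctan_div_bounds hL ht
  have ha' : Real.arctan t' ≤ π / 4 := by rw [← Real.arctan_one]; exact Real.arctan_mono ht'
  have ha'0 : 0 ≤ Real.arctan t' := Real.arctan_nonneg.2 (ht.trans htt')
  have hdiv' : Real.arctan t' / L ≤ π / 4 := (div_le_self ha'0 hL1).trans ha'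
  have hmono : Real.arctan t / L ≤ Real.arctan t' / L := div_le_div_of_nonneg_right (Real.arctan_mono htt') hL'.le
  have htan := tan_sub_tan_le_two_mul h0 hmono hdiv'
  have hlt : Real.arctan t' / L < π / 2 := lt_of_le_of_lt hdiv' (by linarith [Real.pi_pos])
  have htan0 : 0 ≤ Real.tan (Real.arctan t' / L) - Real.tan (Real.arctan t / L) := by
    rcases hmono.eq_or_lt with h | h
    · rw [h, sub_self]
    · exact (sub_pos.2 (Real.tan_lt_tan_of_nonneg_of_lt_pi_div_two h0 hlt h)).le
  have hat : Real.arctan t' - Real.arctan t ≤ t' - t := arctan_sub_arctan_le htt'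
  unfold rootPsi
  refine ⟨by rw [← mul_sub]; exact mul_nonneg hL'.le htan0, ?_⟩
  calc (L : ℝ) * Real.tan (Real.arctan t' / L) - (L : ℝ) * Real.tan (Real.arctan t / L)
      = (L : ℝ) * (Real.tan (Real.arctan t' / L) - Real.tan (Real.arctan t / L)) := by ring
    _ ≤ (L : ℝ) * (2 * (Real.arctan t' / L - Real.arctan t / L)) := mul_le_mul_of_nonneg_left htan hL'.le
    _ = 2 * (Real.arctan t' - Real.arctan t) := by field_simp
    _ ≤ 2 * (t' - t) := by linarith

/-- `|rootPsi L t − rootPsi L t'| ≤ 2|t − t'|` on `[0,1]`, `L ≥ 1`. [folklore] -/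
theorem abs_rootPsi_sub_le {L : ℕ} (hL : 1 ≤ L) {t t' : ℝ} (ht : 0 ≤ t) (ht1 : t ≤ 1) (ht' : 0 ≤ t') (ht'1 : t' ≤ 1) :
    |rootPsi L t - rootPsi L t'| ≤ 2 * |t - t'| := by
  rcases le_total t t' with h | h
  · obtain ⟨h1, h2⟩ := rootPsi_sub_bounds hL ht h ht'1
    rw [abs_sub_comm, abs_of_nonneg h1, abs_sub_comm, abs_of_nonneg (sub_nonneg.2 h)]; exact h2
  · obtain ⟨h1, h2⟩ := rootPsi_sub_bounds hL ht' h ht1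
    rw [abs_of_nonneg h1, abs_of_nonneg (sub_nonneg.2 h)]; exact h2

/-- `rootPsi L t ≤ 2t` on `[0,1]`, `L ≥ 1`. [folklore] -/
theorem rootPsi_le_two_mul {L : ℕ} (hL : 1 ≤ L) {t : ℝ} (ht : 0 ≤ t) (ht1 : t ≤ 1) : rootPsi L t ≤ 2 * t := by
  have h := (rootPsi_sub_bounds hL le_rfl ht ht1).2
  have h0 : rootPsi L 0 = 0 := by simp [rootPsi]
  rw [h0] at h; linarith

/-- **`0 ≤ rootProfile L t ≤ 2`** on `[0,1]`, `L ≥ 1`. [folklore] -/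
theorem rootProfile_bounds {L : ℕ} (hL : 1 ≤ L) {t : ℝ} (ht : 0 ≤ t) (ht1 : t ≤ 1) : 0 ≤ rootProfile L t ∧ rootProfile L t ≤ 2 := by
  rcases ht.eq_or_lt with h | hpos
  · rw [← h]; simp [rootProfile]
  · have hmul := rootProfile_mul_self L t
    have hge : 0 ≤ rootProfile L t * t := by rw [hmul]; exact rootPsi_nonneg hL ht
    have hle : rootProfile L t * t ≤ 2 * t := by rw [hmul]; exact rootPsi_le_two_mul hL ht ht1
    constructor
    · by_contra hneg
      push Not at hneg
      nlinarith [mul_neg_of_neg_of_pos hneg hpos]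
    · by_contra hgt
      push Not at hgt
      nlinarith [mul_lt_mul_of_pos_right hgt hpos]

/-! ## §3 Radial maps on a normed space; the root rescaling is 6-Lipschitz on the chart ball -/

/-- ★ **Radial maps are Lipschitz without a derivative at the origin.**  On a real normed space, if `0 ≤ φ r ≤ A` for `r ∈ [0,1]` and `r ↦ φ(r)·r` is
`B`-Lipschitz on `[0,1]`, then `‖φ(‖z‖)•z − φ(‖z'‖)•z'‖ ≤ (2A + B)·‖z − z'‖` for `‖z‖, ‖z'‖ ≤ 1`. [folklore] -/
theorem norm_radial_sub_radial_le {E : Type*} [NormedAddCommGroup E] [NormedSpace ℝ E] (φ : ℝ → ℝ) {A B : ℝ}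
    (hφ : ∀ r, 0 ≤ r → r ≤ 1 → 0 ≤ φ r ∧ φ r ≤ A) (hψ : ∀ r r', 0 ≤ r → r ≤ 1 → 0 ≤ r' → r' ≤ 1 → |φ r * r - φ r' * r'| ≤ B * |r - r'|)
    {z z' : E} (hz : ‖z‖ ≤ 1) (hz' : ‖z'‖ ≤ 1) :
    ‖φ ‖z‖ • z - φ ‖z'‖ • z'‖ ≤ (2 * A + B) * ‖z - z'‖ := by
  set t := ‖z‖ with ht
  set t' := ‖z'‖ with ht'
  obtain ⟨hφ0, hφA⟩ := hφ t (norm_nonneg _) hz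
  have hA : 0 ≤ A := hφ0.trans hφA
  have hB0 : 0 ≤ B := by
    have h := hψ 1 0 zero_le_one le_rfl le_rfl zero_le_one
    rw [mul_one, mul_zero, sub_zero, sub_zero, abs_one, mul_one] at h
    exact (abs_nonneg _).trans h
  have htt : |t - t'| ≤ ‖z - z'‖ := abs_norm_sub_norm_le z z'
  -- `φ(t)z − φ(t')z' = φ(t)(z − z') + (φ(t) − φ(t'))z'`
  have hsplit : φ t • z - φ t' • z' = φ t • (z - z') + (φ t - φ t') • z' := by
    rw [smul_sub, sub_smul]; abel
  have h1 : ‖φ t • (z - z')‖ ≤ A * ‖z - z'‖ := by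
    rw [norm_smul, Real.norm_eq_abs, abs_of_nonneg hφ0]; exact mul_le_mul_of_nonneg_right hφA (norm_nonneg _)
  -- `|φ(t) − φ(t')|·t' ≤ |φ(t)t' − φ(t)t| + |φ(t)t − φ(t')t'| ≤ (A + B)|t − t'|`
  have h2 : ‖(φ t - φ t') • z'‖ ≤ (A + B) * ‖z - z'‖ := by
    rw [norm_smul, Real.norm_eq_abs, ← ht']
    have e : |φ t - φ t'| * t' = |φ t * t' - φ t' * t'| := by
      rw [← sub_mul, abs_mul, abs_of_nonneg (norm_nonneg z')]
    rw [e]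
    calc |φ t * t' - φ t' * t'| = |(φ t * t' - φ t * t) + (φ t * t - φ t' * t')| := by ring_nf
      _ ≤ |φ t * t' - φ t * t| + |φ t * t - φ t' * t'| := abs_add_le _ _
      _ ≤ A * |t - t'| + B * |t - t'| := by
          refine add_le_add ?_ (hψ t t' (norm_nonneg _) hz (norm_nonneg _) hz')
          rw [← mul_sub, abs_mul, abs_of_nonneg hφ0, abs_sub_comm]
          exact mul_le_mul_of_nonneg_right hφA (abs_nonneg _)
      _ = (A + B) * |t - t'| := by ring
      _ ≤ (A + B) * ‖z - z'‖ := mul_le_mul_of_nonneg_left htt (add_nonneg hA hB0)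
  calc ‖φ t • z - φ t' • z'‖ = ‖φ t • (z - z') + (φ t - φ t') • z'‖ := by rw [hsplit]
    _ ≤ ‖φ t • (z - z')‖ + ‖(φ t - φ t') • z'‖ := norm_add_le _ _
    _ ≤ A * ‖z - z'‖ + (A + B) * ‖z - z'‖ := add_le_add h1 h2
    _ = (2 * A + B) * ‖z - z'‖ := by ring

/-- The link vector `y_i = (y_{(i,a)})_a ∈ ℝ³` of a zero-mode coordinate `y ∈ ZM`. [folklore] -/
def linkVec (y : ZM) (i : Fin 3) : EuclideanSpace ℝ (Fin 3) := WithLp.toLp 2 fun a => y (i, a)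

/-- Coordinates of `linkVec`. [folklore] -/
@[simp] theorem linkVec_apply (y : ZM) (i a : Fin 3) : linkVec y i a = y (i, a) := rfl

/-- `‖linkVec y i‖² = linkNormSq y i`. [folklore] -/
theorem norm_linkVec_sq (y : ZM) (i : Fin 3) : ‖linkVec y i‖ ^ 2 = linkNormSq y i := by
  rw [EuclideanSpace.real_norm_sq_eq, linkNormSq]; rfl

/-- `‖linkVec y i‖ = √(linkNormSq y i)`. [folklore] -/
theorem norm_linkVec (y : ZM) (i : Fin 3) : ‖linkVec y i‖ = Real.sqrt (linkNormSq y i) := by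
  rw [← norm_linkVec_sq, Real.sqrt_sq (norm_nonneg _)]

/-- `‖y‖² = Σ_i ‖linkVec y i‖²`. [folklore] -/
theorem norm_sq_eq_sum_linkVec (y : ZM) : ‖y‖ ^ 2 = ∑ i, ‖linkVec y i‖ ^ 2 := by
  rw [EuclideanSpace.real_norm_sq_eq, Fintype.sum_prod_type]
  refine Finset.sum_congr rfl fun i _ => ?_
  rw [EuclideanSpace.real_norm_sq_eq]; rfl

/-- `linkVec` is additive: `linkVec (y − y') i = linkVec y i − linkVec y' i`. [folklore] -/
theorem linkVec_sub (y y' : ZM) (i : Fin 3) : linkVec (y - y') i = linkVec y i - linkVec y' i := by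
  ext a; simp [linkVec]

/-- The root rescaling acts radially on each link vector: `linkVec (rootRescale L μ y) i = rootProfile L (μ‖y_i‖) • y_i`. [folklore] -/
theorem linkVec_rootRescale (L : ℕ) (μ : ℝ) (y : ZM) (i : Fin 3) :
    linkVec (rootRescale L μ y) i = rootProfile L (μ * ‖linkVec y i‖) • linkVec y i := by
  rw [norm_linkVec]
  ext a
  simp [linkVec, rootRescale_apply]

/-- ★ **The root rescaling is 6-Lipschitz on the chart ball**: for `L ≥ 1`, `μ > 0` and `y, y' ∈ ZM` with `μ‖y_i‖ ≤ 1`, `μ‖y'_i‖ ≤ 1` for every link,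
`‖rootRescale L μ y − rootRescale L μ y'‖ ≤ 6·‖y − y'‖`. [cite: Luscher1983, §2] -/
theorem norm_rootRescale_sub_le {L : ℕ} (hL : 1 ≤ L) {μ : ℝ} (hμ : 0 < μ) {y y' : ZM}
    (hy : ∀ i, μ * ‖linkVec y i‖ ≤ 1) (hy' : ∀ i, μ * ‖linkVec y' i‖ ≤ 1) :
    ‖rootRescale L μ y - rootRescale L μ y'‖ ≤ 6 * ‖y - y'‖ := by
  -- per link: the radial lemma for `φ = rootProfile L` at the scaled vectors `μ•y_i`
  have hφ : ∀ r, 0 ≤ r → r ≤ 1 → 0 ≤ rootProfile L r ∧ rootProfile L r ≤ 2 := fun r h0 h1 => rootProfile_bounds hL h0 h1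
  have hψ : ∀ r r', 0 ≤ r → r ≤ 1 → 0 ≤ r' → r' ≤ 1 → |rootProfile L r * r - rootProfile L r' * r'| ≤ 2 * |r - r'| := fun r r' h0 h1 h0' h1' => by
    rw [rootProfile_mul_self, rootProfile_mul_self]; exact abs_rootPsi_sub_le hL h0 h1 h0' h1'
  have hlink : ∀ i, ‖linkVec (rootRescale L μ y) i - linkVec (rootRescale L μ y') i‖ ≤ 6 * ‖linkVec y i - linkVec y' i‖ := by
    intro i
    have hzn : ‖μ • linkVec y i‖ = μ * ‖linkVec y i‖ := by rw [norm_smul, Real.norm_eq_abs, abs_of_pos hμ]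
    have hzn' : ‖μ • linkVec y' i‖ = μ * ‖linkVec y' i‖ := by rw [norm_smul, Real.norm_eq_abs, abs_of_pos hμ]
    have hrad := norm_radial_sub_radial_le (E := EuclideanSpace ℝ (Fin 3)) (rootProfile L) hφ hψ (z := μ • linkVec y i)
      (z' := μ • linkVec y' i) (by rw [hzn]; exact hy i) (by rw [hzn']; exact hy' i)
    have e1 : μ • (linkVec (rootRescale L μ y) i - linkVec (rootRescale L μ y') i) =
        rootProfile L ‖μ • linkVec y i‖ • (μ • linkVec y i) - rootProfile L ‖μ • linkVec y' i‖ • (μ • linkVec y' i) := by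
      rw [linkVec_rootRescale, linkVec_rootRescale, hzn, hzn', smul_sub, smul_comm μ (rootProfile L _) (linkVec y i),
        smul_comm μ (rootProfile L _) (linkVec y' i)]
    have e2 : μ • linkVec y i - μ • linkVec y' i = μ • (linkVec y i - linkVec y' i) := (smul_sub _ _ _).symm
    rw [← e1, e2, norm_smul, norm_smul, Real.norm_eq_abs, abs_of_pos hμ] at hrad
    have h6 : μ * ‖linkVec (rootRescale L μ y) i - linkVec (rootRescale L μ y') i‖ ≤ μ * (6 * ‖linkVec y i - linkVec y' i‖) := by
      linarith
    exact le_of_mul_le_mul_left h6 hμ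
  -- sum the squares over the links
  have hsq : ‖rootRescale L μ y - rootRescale L μ y'‖ ^ 2 ≤ (6 * ‖y - y'‖) ^ 2 := by
    rw [norm_sq_eq_sum_linkVec, mul_pow, norm_sq_eq_sum_linkVec, Finset.mul_sum]
    refine Finset.sum_le_sum fun i _ => ?_
    rw [linkVec_sub, linkVec_sub]
    have h := hlink i
    have h0 : 0 ≤ ‖linkVec (rootRescale L μ y) i - linkVec (rootRescale L μ y') i‖ := norm_nonneg _
    calc ‖linkVec (rootRescale L μ y) i - linkVec (rootRescale L μ y') i‖ ^ 2 ≤ (6 * ‖linkVec y i - linkVec y' i‖) ^ 2 :=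
          pow_le_pow_left₀ h0 h 2
      _ = 6 ^ 2 * ‖linkVec y i - linkVec y' i‖ ^ 2 := by ring
  exact (pow_le_pow_iff_left₀ (norm_nonneg _) (by positivity) two_ne_zero).1 hsq

end Summit.QuantumFields.YangMills.Theorems.FemtoTransferGap.PolyakovLift

end
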